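import Summits.CriticalPhenomena.SAWScalingLimit.Theorems.SAWLeftRightFKGFKGToTraversalBoundSlitPresentation
import Summits.CriticalPhenomena.SAWScalingLimit.Theorems.SAWLeftRightFKGFKGToTraversalBoundSweep
import HarnessLib

/-!
# Slit necklace, piece 4: the HUNG presentation (r2 half of the disintegrations (T) and (B))

Crux `SAWLeftRightFKG.FKGToTraversalBound` (stmt-CriticalPhenomena-1878), line
`gates-by-bubble-doors-by-fkg`, registered helper `necklace_hungPresentation` of the stub `stub_necklace`
(`SAWCollarBound → GermExcursionMean → DeepShellTight`); it is the combine partner's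
`SlitNecklace.stub_hungPresentation` (skeleton `Lines/slit_necklace.lean`, STUB 2) with the harmless extra
hypothesis that the target `b` is a non-isolated vertex of the carrier.

`C : c → c` is a closed lattice walk, `Ω = dom C δ = {wind ≠ 0}` its r2 carrier, `K` a finite set of
sites, ATTACHED to `C` (every `k ∈ K` is joined to a vertex of `C` by a lattice walk through
`K ∪ C.support`), `b ∉ K` a non-isolated vertex of `Ω_δ`, and
`Keep = {v | some walk v → b of Ω_δ avoids K}`.  Then some closed walk `C' : c → c` through all of
`C.support` and all of `K` PRESENTS the hung carrier: `(dom C' δ)_δ` is `Ω_δ` restricted to `Keep`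
(`necklace_hungPresentation`).  In the necklace `K` = slit ∪ necklace ∪ frozen pieces (attached through the
slit's boundary end), `b` = the target of the piece being resampled; by the trace dichotomy
(`NecklaceCarrier`) the piece's endpoints are then `C'`-adjacent, so `SAWCollarBound` / the uniform engine
apply to it — the r2 half of (T) and (B); the weight half is the landed domain Markov property
(`weight_prefix`, `weight_restrict`, p85820).

Proof = the landed `slitPresentation_one` (p102570) with the prefix path replaced by `K`: at mesh `1`
sweep `K ∪ (meshVertices ∖ Keep)` — a mesh vertex off `Keep ∪ K` walks EAST through such vertices until
it meets the trace, or a site of `K` (attached by hypothesis); it never meets `Keep` (a mesh vertex off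
`K` next to `Keep` is in `Keep`) — by the landed sweep lemma `stub_sweep` (p100023); the swept walk has
the same index off its trace, so its mesh vertices are exactly `Keep`, adjacent `Keep` sites are
mesh-adjacent (`segment_subset_dom_one`), `Keep` is connected through `b`, hence it is the discrete domain
(`meshDomain_eq_meshVertices_of_preconnected`) with the induced adjacency; transport to mesh `δ` along
`CornerLoc.discreteDomainGraph_dom`.  Only theorems; no named fact; axioms are the standard three.
-/

noncomputable section

open Set
open Literature.Probability.LatticeModels Literature.Probability.RandomPlanarGeometry
open Literature.Topology.PlaneTopology
open Summit.CriticalPhenomena.SAWScalingLimit.Theorems.FKGToTraversalBound.Negative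
  (dom notMem_dom_of_mem_support wind_sub_eq_zero_of_mem_range)
open Summit.CriticalPhenomena.SAWScalingLimit.Theorems.FKGToTraversalBound.ExcursionDomination
  (exists_walk_of_graph_eq reachable_induce_of_walk mem_meshDomain_of_adj mem_support_of_pt_mem_range
    notMem_range_of_mem_dom notMem_support_of_mem_meshVertices segment_subset_dom_one meshGraph_adj_of_adj
    stub_sweep)
open Summit.CriticalPhenomena.SAWScalingLimit.Theorems.LeftRightFKG.Negative (pt meshPoint_one)
open Summit.CriticalPhenomena.SAWScalingLimit.Theorems.LeftRightFKG.CornerLoc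
  (support_subset_of_walk isBounded_dom discreteDomainGraph_dom)
open Literature.Probability.Percolation (meshDomain_eq_meshVertices_of_preconnected)

namespace Summit.CriticalPhenomena.SAWScalingLimit.Theorems.FKGToTraversalBound.GatesByBubbleDoorsByFKG

/-! ### The hung presentation at mesh `1` -/

/-- **Hung presentation at mesh `1`.**  For a closed lattice walk `C`, a finite ATTACHED set `K` and a
non-isolated vertex `b ∉ K` of `Ω_1 = (dom C 1)_1`, some closed walk `C' : c → c` through `C.support ∪ K`
presents `Ω_1` restricted to `Keep = {v | some walk v → b of Ω_1 avoids K}`. [folklore] -/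
theorem hungPresentation_one {c b : Site 2} (C : (zdGraph 2).Walk c c) (K : Finset (Site 2))
    (hbK : b ∉ K) (hb : ∃ w : Site 2, (discreteDomainGraph (dom C 1) 1).Adj b w)
    (hK : ∀ k ∈ K, ∃ (q : Site 2) (p : (zdGraph 2).Walk k q), q ∈ C.support ∧
      ∀ x ∈ p.support, x ∈ K ∨ x ∈ C.support) :
    ∃ C' : (zdGraph 2).Walk c c, (∀ x ∈ C.support, x ∈ C'.support) ∧ (∀ k ∈ K, k ∈ C'.support) ∧
      ∀ x y : Site 2, (discreteDomainGraph (dom C' 1) 1).Adj x y ↔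
        ((discreteDomainGraph (dom C 1) 1).Adj x y ∧
          (∃ q : (discreteDomainGraph (dom C 1) 1).Walk x b, ∀ v ∈ q.support, v ∉ K) ∧
          (∃ q : (discreteDomainGraph (dom C 1) 1).Walk y b, ∀ v ∈ q.support, v ∉ K)) := by
  classical
  -- the set `Keep` of sites joined to `b` off `K`
  obtain ⟨Keep, hKeep⟩ : ∃ Keep : Set (Site 2), ∀ v, v ∈ Keep ↔
      ∃ q : (discreteDomainGraph (dom C 1) 1).Walk v b, ∀ x ∈ q.support, x ∉ K :=
    ⟨{v | ∃ q : (discreteDomainGraph (dom C 1) 1).Walk v b, ∀ x ∈ q.support, x ∉ K}, fun v => Iff.rfl⟩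
  have hGle : discreteDomainGraph (dom C 1) 1 ≤ zdGraph 2 :=
    (discreteDomainGraph_le_meshGraph _ _).trans (meshGraph_le_zdGraph _ _)
  -- bookkeeping: `b` and `Keep` lie in `Ω_1`
  have hbD : b ∈ meshDomain (dom C 1) 1 := hb.elim fun w hw => (discreteDomainGraph_adj_iff.1 hw).2.1
  have hbKeep : b ∈ Keep := by
    refine (hKeep b).2 ⟨SimpleGraph.Walk.nil, fun x hx => ?_⟩
    rw [SimpleGraph.Walk.support_nil, List.mem_singleton] at hx
    subst hx
    exact hbK
  have hKeepD : ∀ v ∈ Keep, v ∈ meshDomain (dom C 1) 1 := fun v hv => ((hKeep v).1 hv).elim fun q _ =>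
    (support_subset_of_walk q.reverse v q.reverse.end_mem_support).elim (· ▸ hbD) id
  have hKeepV : ∀ v ∈ Keep, v ∈ meshVertices (dom C 1) 1 :=
    fun v hv => meshDomain_subset_meshVertices _ _ (hKeepD v hv)
  have hKeep_notC : ∀ v ∈ Keep, v ∉ C.support :=
    fun v hv => notMem_support_of_mem_meshVertices C 1 (hKeepV v hv)
  have hKeep_notK : ∀ v ∈ Keep, v ∉ K := fun v hv =>
    ((hKeep v).1 hv).elim fun q hq => hq v q.start_mem_support
  have hKeep_of_walk : ∀ (v : Site 2) (q : (discreteDomainGraph (dom C 1) 1).Walk v b),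
      (∀ x ∈ q.support, x ∉ K) → ∀ x ∈ q.support, x ∈ Keep := fun v q hq x hx =>
    (hKeep x).2 ⟨q.dropUntil x hx, fun y hy => hq y (q.support_dropUntil_subset_support hx hy)⟩
  -- a mesh vertex off `K` next to a `Keep` site is a `Keep` site
  have hKeep_adj : ∀ u w : Site 2, w ∈ Keep → u ∈ meshVertices (dom C 1) 1 → (zdGraph 2).Adj u w →
      u ∉ K → u ∈ Keep := by
    intro u w hw hu huw huK
    obtain ⟨q, hq⟩ := (hKeep w).1 hw
    have hmesh : (meshGraph (dom C 1) 1).Adj u w := meshGraph_adj_of_adj C huw hu (hKeep_notC w hw)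
    have huD := mem_meshDomain_of_adj hu (hKeepD w hw) hmesh
    refine (hKeep u).2 ⟨SimpleGraph.Walk.cons (discreteDomainGraph_adj_iff.2 ⟨hmesh, huD, hKeepD w hw⟩) q, ?_⟩
    intro x hx
    rw [SimpleGraph.Walk.support_cons, List.mem_cons] at hx
    rcases hx with rfl | hx
    · exact huK
    · exact hq x hx
  -- the sweep set `S = K ∪ (meshVertices ∖ Keep)`
  have hbdd : Bornology.IsBounded (dom C 1) := isBounded_dom C 1
  have hVfin : (meshVertices (dom C 1) 1).Finite := meshVertices_finite hbdd one_pos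
  set S : Finset (Site 2) := K ∪ hVfin.toFinset.filter (fun v => v ∉ Keep) with hSdef
  have hSmem : ∀ k, k ∈ S ↔ k ∈ K ∨ (k ∈ meshVertices (dom C 1) 1 ∧ k ∉ Keep) := fun k => by
    rw [hSdef, Finset.mem_union, Finset.mem_filter, Set.Finite.mem_toFinset]
  have hKS : ∀ k ∈ K, k ∈ S := fun k hk => (hSmem k).2 (Or.inl hk)
  -- attachment of the `K`-part (by hypothesis)
  have hattK : ∀ k ∈ K, ∃ (q : Site 2) (p : (zdGraph 2).Walk k q), q ∈ C.support ∧
      ∀ x ∈ p.support, x ∈ S ∨ x ∈ C.support := by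
    intro k hk
    obtain ⟨q, p, hq, hp⟩ := hK k hk
    exact ⟨q, p, hq, fun x hx => (hp x hx).imp_left (hKS x)⟩
  -- attachment of the mesh part: walk east
  obtain ⟨m, -, hm⟩ := Set.exists_max_image _ (fun x : Site 2 => x 0) hVfin ⟨b, meshDomain_subset_meshVertices _ _ hbD⟩
  set e₀ : Site 2 := Pi.single 0 1 with he₀
  have hadjE : ∀ k : Site 2, (zdGraph 2).Adj k (k + e₀) := fun k => (zdGraph_adj_iff _ _).2 ⟨0, Or.inl rfl⟩
  have he0 : ∀ k : Site 2, (k + e₀) 0 = k 0 + 1 := fun k => by simp [he₀]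
  have key : ∀ n : ℕ, ∀ k, k ∈ meshVertices (dom C 1) 1 → k ∉ Keep → k ∉ K → m 0 - k 0 ≤ n →
      ∃ (q : Site 2) (p : (zdGraph 2).Walk k q), q ∈ C.support ∧ ∀ x ∈ p.support, x ∈ S ∨ x ∈ C.support := by
    intro n
    induction n with
    | zero =>
      intro k hkV hkKeep hkK hn
      have hkS : k ∈ S := (hSmem k).2 (Or.inr ⟨hkV, hkKeep⟩)
      by_cases hk'C : k + e₀ ∈ C.support
      · refine ⟨k + e₀, SimpleGraph.Walk.cons (hadjE k) SimpleGraph.Walk.nil, hk'C, fun x hx => ?_⟩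
        rw [SimpleGraph.Walk.support_cons, SimpleGraph.Walk.support_nil, List.mem_cons, List.mem_singleton] at hx
        rcases hx with rfl | rfl
        · exact Or.inl hkS
        · exact Or.inr hk'C
      · exfalso
        have hk'V : k + e₀ ∈ meshVertices (dom C 1) 1 := by
          rw [mem_meshVertices_iff, meshPoint_one] at hkV ⊢
          exact segment_subset_dom_one C (hadjE k) hkV hk'C (right_mem_segment _ _ _)
        have h1 := hm _ hk'V
        rw [he0] at h1; push_cast at hn; omega
    | succ n ih =>
      intro k hkV hkKeep hkK hn
      have hkS : k ∈ S := (hSmem k).2 (Or.inr ⟨hkV, hkKeep⟩)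
      by_cases hk'C : k + e₀ ∈ C.support
      · refine ⟨k + e₀, SimpleGraph.Walk.cons (hadjE k) SimpleGraph.Walk.nil, hk'C, fun x hx => ?_⟩
        rw [SimpleGraph.Walk.support_cons, SimpleGraph.Walk.support_nil, List.mem_cons, List.mem_singleton] at hx
        rcases hx with rfl | rfl
        · exact Or.inl hkS
        · exact Or.inr hk'C
      · by_cases hk'K : k + e₀ ∈ K
        · obtain ⟨q, p, hqC, hp⟩ := hattK _ hk'K
          refine ⟨q, SimpleGraph.Walk.cons (hadjE k) p, hqC, fun x hx => ?_⟩
          rw [SimpleGraph.Walk.support_cons, List.mem_cons] at hx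
          rcases hx with rfl | hx
          · exact Or.inl hkS
          · exact hp x hx
        · have hk'V : k + e₀ ∈ meshVertices (dom C 1) 1 := by
            rw [mem_meshVertices_iff, meshPoint_one] at hkV ⊢
            exact segment_subset_dom_one C (hadjE k) hkV hk'C (right_mem_segment _ _ _)
          have hk'Keep : k + e₀ ∉ Keep := fun h => hkKeep (hKeep_adj k (k + e₀) h hkV (hadjE k) hkK)
          obtain ⟨q, p, hqC, hp⟩ := ih _ hk'V hk'Keep hk'K (by rw [he0]; push_cast at hn ⊢; omega)
          refine ⟨q, SimpleGraph.Walk.cons (hadjE k) p, hqC, fun x hx => ?_⟩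
          rw [SimpleGraph.Walk.support_cons, List.mem_cons] at hx
          rcases hx with rfl | hx
          · exact Or.inl hkS
          · exact hp x hx
  have hattS : ∀ k ∈ S, ∃ (q : Site 2) (p : (zdGraph 2).Walk k q), q ∈ C.support ∧
      ∀ x ∈ p.support, x ∈ S ∨ x ∈ C.support := by
    intro k hk
    by_cases hkK : k ∈ K
    · exact hattK k hkK
    · rcases (hSmem k).1 hk with h | ⟨hkV, hkKeep⟩
      · exact absurd h hkK
      · exact key (m 0 - k 0).toNat k hkV hkKeep hkK (Int.self_le_toNat _)
  -- sweep
  obtain ⟨C', hC'supp, hC'wind⟩ := stub_sweep c C S hattS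
  have hKeep_notC' : ∀ x ∈ Keep, x ∉ C'.support := fun x hx h =>
    ((hC'supp x).1 h).elim (hKeep_notC x hx) fun hS =>
      ((hSmem x).1 hS).elim (hKeep_notK x hx) fun h2 => h2.2 hx
  -- the new mesh vertices are `Keep` (the index is unchanged off the new trace)
  have hV' : ∀ x, x ∈ meshVertices (dom C' 1) 1 ↔ x ∈ Keep := by
    intro x
    rw [mem_meshVertices_iff, meshPoint_one]
    constructor
    · intro hx
      have hxT' : pt x ∉ Set.range (C'.toCurve (meshPoint 1)) := notMem_range_of_mem_dom C' 1 hx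
      obtain ⟨-, hw⟩ := hC'wind 1 (pt x) one_pos hxT'
      have hxV : x ∈ meshVertices (dom C 1) 1 := by
        rw [mem_meshVertices_iff, meshPoint_one]; change wind _ ≠ 0; rw [← hw]; exact hx
      have hxC' : x ∉ C'.support := fun h =>
        hxT' (by simpa only [meshPoint_one] using C'.mem_range_toCurve (meshPoint 1) h)
      by_contra hxK
      exact hxC' ((hC'supp x).2 (Or.inr ((hSmem x).2 (Or.inr ⟨hxV, hxK⟩))))
    · intro hx
      have hxV : pt x ∈ dom C 1 := by
        have h := hKeepV x hx
        rwa [mem_meshVertices_iff, meshPoint_one] at h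
      obtain ⟨-, hw⟩ := hC'wind 1 (pt x) one_pos fun h => hKeep_notC' x hx (mem_support_of_pt_mem_range C' h)
      change wind _ ≠ 0; rw [hw]; exact hxV
  -- adjacent `Keep` sites are joined in the new mesh graph
  have hmesh' : ∀ x y, x ∈ Keep → y ∈ Keep → (zdGraph 2).Adj x y → (meshGraph (dom C' 1) 1).Adj x y :=
    fun x y hx hy hxy => meshGraph_adj_of_adj C' hxy ((hV' x).2 hx) (hKeep_notC' y hy)
  -- the new mesh-vertex graph is preconnected (through `b`), so the new discrete domain is `Keep`
  have hpre : (meshVertexGraph (dom C' 1) 1).Preconnected := by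
    have hreach : ∀ u : meshVertices (dom C' 1) 1,
        (meshVertexGraph (dom C' 1) 1).Reachable u ⟨b, (hV' b).2 hbKeep⟩ := by
      rintro ⟨u, hu⟩
      obtain ⟨q, hq⟩ := (hKeep u).1 ((hV' u).1 hu)
      exact reachable_induce_of_walk (G := discreteDomainGraph (dom C 1) 1) (H := meshGraph (dom C' 1) 1)
        (S := meshVertices (dom C' 1) 1)
        (fun x y hx hy hxy => hmesh' x y ((hV' x).1 hx) ((hV' y).1 hy) (hGle hxy))
        q (fun x hx => (hV' x).2 (hKeep_of_walk u q hq x hx)) hu _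
    exact fun u v => (hreach u).trans (hreach v).symm
  -- conclusion
  refine ⟨C', fun x hx => (hC'supp x).2 (Or.inl hx), fun k hk => (hC'supp k).2 (Or.inr (hKS k hk)),
    fun x y => ?_⟩
  rw [discreteDomainGraph_adj_iff, meshDomain_eq_meshVertices_of_preconnected hpre, hV', hV']
  constructor
  · rintro ⟨hm', hx, hy⟩
    exact ⟨discreteDomainGraph_adj_iff.2 ⟨meshGraph_adj_of_adj C (meshGraph_le_zdGraph _ _ hm') (hKeepV x hx)
      (hKeep_notC y hy), hKeepD x hx, hKeepD y hy⟩, (hKeep x).1 hx, (hKeep y).1 hy⟩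
  · rintro ⟨hG', hx, hy⟩
    exact ⟨hmesh' x y ((hKeep x).2 hx) ((hKeep y).2 hy) (hGle hG'), (hKeep x).2 hx, (hKeep y).2 hy⟩

/-! ### The registered helper (any mesh) -/

/-- **Registered helper `necklace_hungPresentation`** (crux stmt-CriticalPhenomena-1878, stub
`stub_necklace`; the combine partner's `stub_hungPresentation` with `b` non-isolated): **every hung
carrier is r2.**  For a closed lattice walk `C`, mesh `δ > 0`, a finite set `K` of sites ATTACHED to `C`
(each joined to a vertex of `C` through `K ∪ C.support`) and a non-isolated vertex `b ∉ K` of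
`Ω_δ = (dom C δ)_δ`, some closed walk `C' : c → c` through all of `C.support` and all of `K` presents the
hung carrier: `(dom C' δ)_δ` is `Ω_δ` restricted to `Keep(b, K) = {v | some walk v → b of Ω_δ avoids K}`
(graph equality; sealed pockets, dropped lobes and the largest-component convention swept onto the
trace).  Reduced to mesh `1` (`hungPresentation_one`) along `CornerLoc.discreteDomainGraph_dom`.
[folklore] -/
theorem necklace_hungPresentation :
    ∀ (δ : ℝ) (c b : Site 2) (C : (zdGraph 2).Walk c c) (K : Finset (Site 2)),
      0 < δ → b ∉ K → (∃ w : Site 2, (discreteDomainGraph (dom C δ) δ).Adj b w) →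
      (∀ k ∈ K, ∃ (q : Site 2) (p : (zdGraph 2).Walk k q), q ∈ C.support ∧
        ∀ x ∈ p.support, x ∈ K ∨ x ∈ C.support) →
      ∃ C' : (zdGraph 2).Walk c c,
        (∀ x ∈ C.support, x ∈ C'.support) ∧ (∀ k ∈ K, k ∈ C'.support) ∧
        ∀ x y : Site 2, (discreteDomainGraph (dom C' δ) δ).Adj x y ↔
          ((discreteDomainGraph (dom C δ) δ).Adj x y ∧
            (∃ q : (discreteDomainGraph (dom C δ) δ).Walk x b, ∀ v ∈ q.support, v ∉ K) ∧
            (∃ q : (discreteDomainGraph (dom C δ) δ).Walk y b, ∀ v ∈ q.support, v ∉ K)) := by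
  intro δ c b C K hδ hbK hb hK
  have hG : discreteDomainGraph (dom C δ) δ = discreteDomainGraph (dom C 1) 1 := discreteDomainGraph_dom C hδ.ne'
  have hex : ∀ z : Site 2,
      (∃ q : (discreteDomainGraph (dom C δ) δ).Walk z b, ∀ v ∈ q.support, v ∉ K) ↔
        ∃ q : (discreteDomainGraph (dom C 1) 1).Walk z b, ∀ v ∈ q.support, v ∉ K := by
    intro z
    exact ⟨fun ⟨q, hq⟩ => (exists_walk_of_graph_eq hG q).elim fun q' h => ⟨q', fun v hv => hq v (h.1 ▸ hv)⟩,
      fun ⟨q, hq⟩ => (exists_walk_of_graph_eq hG.symm q).elim fun q' h => ⟨q', fun v hv => hq v (h.1 ▸ hv)⟩⟩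
  have hb₁ : ∃ w : Site 2, (discreteDomainGraph (dom C 1) 1).Adj b w := by rw [← hG]; exact hb
  obtain ⟨C', h1, h2, h3⟩ := hungPresentation_one C K hbK hb₁ hK
  refine ⟨C', h1, h2, fun x y => ?_⟩
  rw [show discreteDomainGraph (dom C' δ) δ = discreteDomainGraph (dom C' 1) 1 from
    discreteDomainGraph_dom C' hδ.ne', h3, hex, hex, hG]

end Summit.CriticalPhenomena.SAWScalingLimit.Theorems.FKGToTraversalBound.GatesByBubbleDoorsByFKG

end
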